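import Literature.Barriers.AnomalousDissipation.MeasureValuedWeakStrong
import Literature.Analysis.FluidPDE.LerayEulerGronwall
import HarnessLib

/-!
# Proof of Brenier–De Lellis–Székelyhidi 2011, Cor. 1: Leray solutions converge to a regular
Euler solution while one exists

Sibling proofs file of `MeasureValuedWeakStrong.lean` (D-0014); no new definitions. The named
fact `BrenierDeLellisSzekelyhidi2011_cor1` (Brenier–De Lellis–Székelyhidi, CMP 305 (2011),
Cor. 1 with Thm. 2 and condition (8)) is **discharged**:
`BrenierDeLellisSzekelyhidi2011_cor1_holds`.

## The argument (and where it deviates from the printed one)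

The source proves Cor. 1 through admissible measure-valued solutions (Prop. 1: Leray solutions
generate them; Thm. 2: weak–strong uniqueness for them, via a relative-energy Grönwall argument
in which `‖v‖_∞` is controlled by Korn's inequality and Sobolev embedding and the pressure
`p ∈ L²` handles the spatial cut-off `φ_k v`). The formalisation runs the *same relative-energy
argument directly on each Leray solution* `u = u_k`, with the spatially mollified field
`φ ⋆ v` as test field instead of the cut-off `φ_k v` (so no pressure is needed), and with one
structural observation replacing Korn/Sobolev: for divergence-free tests `Φ`,
`∫⟪v,(v·∇)Φ⟫ = -∫⟪S v, Φ⟫` with `S = ∇v + ∇vᵀ` (pointwise `(v·∇)v = S v - ∇(½|v|²)`), whence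
`∂ₜ v = -P(S v) ∈ L¹(0,T; L²)` under (8) and `∫⟪S v, v⟫ = 0` (energy conservation). The files
`EulerSymmetricGradient`, `MollifiedSolenoidalTest`, `EulerSymGradientSlice`,
`EulerSymGradEnergy`, `MollifiedSliceTools`, `LerayEulerCross`, `LerayEulerGronwall`
(`Literature/Analysis/FluidPDE/`) carry this out: cross identity by Serrin's doubling of the
time variable, slice-wise algebra (10)–(13) of the source, Grönwall. The present file performs
the two limits: the spatial mollification scale `φ_m → δ₀` (the error
`2‖v₀‖(‖v₀ - φ⋆v₀‖ + sup‖v - φ⋆v‖) + 2∫₀ᵀ err_φ` tends to `0`: uniform mollification on the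
compact family `{v(s)}`, and dominated convergence in time for `err_φ`, which vanishes slice-wise
because `φ⋆(Sv) → Sv`, `(φ⋆S)v → Sv` in `L²` and `∫⟪Sv,v⟫ = 0`), and then `ν_k → 0` (the only
`u_k`-dependent error is `2Tν_k‖v₀‖‖Δφ_m‖₁ R`). The uniform-in-`k` bound
`∫₀ᵀ∫|u_k - v|² ≤ T · α(φ_m, ν_k) · exp ∫₀ᵀ‖S‖_∞` gives the claim. The conclusion proved is in
fact convergence in `L^∞(0,T; L²)`, stronger than the printed `L²((0,T) × ℝⁿ)`.

## References

* Y. Brenier, C. De Lellis, L. Székelyhidi Jr., *Weak-strong uniqueness for measure-valued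
  solutions*, Comm. Math. Phys. 305 (2011) 351–361, §3, Prop. 1, Def. 1, Thm. 2 with (8),
  Cor. 1, and the proof of Thm. 2, (9)–(13) (arXiv:0912.1028, pp. 5–6).
  [BrenierDeLellisSzekelyhidi2011]
-/

noncomputable section

open MeasureTheory TopologicalSpace Set Function Filter ContinuousLinearMap InnerProductSpace
  Literature.Analysis.FluidPDE Literature.Analysis
open scoped ENNReal NNReal Convolution RealInnerProductSpace Topology Laplacian

namespace Literature.Barriers.AnomalousDissipation

variable {E : Type*} [NormedAddCommGroup E] [InnerProductSpace ℝ E] [FiniteDimensional ℝ E]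
  [MeasurableSpace E] [BorelSpace E] [CompleteSpace E]

/-! ### Uniform mollification of a field continuous into `L²` -/

section Uniform

omit [CompleteSpace E] in
/-- **Mollification converges uniformly on a continuous `L²`-valued path.** If
`v ∈ C([0,T]; L²)` and `φ_m` are bump kernels with `rOut → 0`, then for every `ε > 0`,
`‖v(s) - φ_m ⋆ v(s)‖_{L²} ≤ ε` for all `s ∈ [0,T]` and all large `m` (finite `ε/3`-net of the
compact set `{v(s)}`; the mollifications are `L²`-contractions converging strongly). [folklore] -/
theorem eventually_forall_eLpNorm_sub_normed_convolution_le {T : ℝ} {v : ℝ → E → E}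
    (hc : ContinuousInLpOn (Icc 0 T) 2 v) {φ : ℕ → ContDiffBump (0 : E)}
    (hφ : Tendsto (fun m => (φ m).rOut) atTop (𝓝 0)) {ε : ℝ} (hε : 0 < ε) :
    ∀ᶠ m in atTop, ∀ s ∈ Icc 0 T,
      (eLpNorm (v s - (φ m).normed volume ⋆[lsmul ℝ ℝ, volume] v s) 2 volume).toReal ≤ ε := by
  obtain ⟨U, hUc, hU⟩ := hc.exists_continuousOn_toLp
  have hK : IsCompact (U '' Icc 0 T) := isCompact_Icc.image_of_continuousOn hUc
  obtain ⟨net, hnetK, hnetfin, hcover⟩ := hK.finite_cover_balls (show (0 : ℝ) < ε / 3 by positivity)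
  -- each net point is `U s_j`, `s_j ∈ [0,T]`
  have hnet : ∀ p ∈ net, ∃ s ∈ Icc 0 T, U s = p := fun p hp => by
    obtain ⟨s, hs, rfl⟩ := hnetK hp; exact ⟨s, hs, rfl⟩
  choose! sj hsj hUsj using hnet
  -- the mollifications converge at the finitely many net times
  have hconv : ∀ p ∈ net, ∀ᶠ m in atTop,
      eLpNorm ((φ m).normed volume ⋆[lsmul ℝ ℝ, volume] v (sj p) - v (sj p)) 2 volume <
        ENNReal.ofReal (ε / 3) := fun p hp =>
    (tendsto_order.1 (FunctionSpaces.tendsto_eLpNorm_normed_convolution_sub_self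
      (μ := (volume : Measure E)) hφ one_le_two ENNReal.ofNat_ne_top (hc.1 _ (hsj p hp)))).2 _
      (ENNReal.ofReal_pos.2 (by positivity))
  have hall : ∀ᶠ m in atTop, ∀ p ∈ net,
      eLpNorm ((φ m).normed volume ⋆[lsmul ℝ ℝ, volume] v (sj p) - v (sj p)) 2 volume <
        ENNReal.ofReal (ε / 3) := hnetfin.eventually_all.2 hconv
  filter_upwards [hall] with m hm s hs
  -- pick a net point `ε/3`-close to `U s`
  have hUs : U s ∈ ⋃ p ∈ net, Metric.ball p (ε / 3) := hcover (mem_image_of_mem U hs)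
  simp only [mem_iUnion, Metric.mem_ball, exists_prop] at hUs
  obtain ⟨p, hp, hdist⟩ := hUs
  have hsj' := hsj p hp
  have h2s := hc.1 s hs
  have h2j := hc.1 _ hsj'
  set w : E → E := v (sj p) with hw
  set ψ := (φ m).normed volume with hψ
  -- `‖v s - v s_j‖ < ε/3`
  have hd1 : eLpNorm (v s - w) 2 volume < ENNReal.ofReal (ε / 3) := by
    rw [ENNReal.lt_ofReal_iff_toReal_lt (h2s.sub h2j).eLpNorm_ne_top]
    have : dist (U s) p = (eLpNorm (v s - w) 2 volume).toReal := by
      rw [← hUsj p hp, hU s hs, hU _ hsj', dist_eq_norm, ← MemLp.toLp_sub, Lp.norm_toLp]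
    rwa [this] at hdist
  have hd2 : eLpNorm (w - ψ ⋆[lsmul ℝ ℝ, volume] w) 2 volume < ENNReal.ofReal (ε / 3) := by
    rw [eLpNorm_sub_comm]; exact hm p hp
  have hd3 : eLpNorm (ψ ⋆[lsmul ℝ ℝ, volume] w - ψ ⋆[lsmul ℝ ℝ, volume] v s) 2 volume <
      ENNReal.ofReal (ε / 3) := by
    rw [← normed_convolution_sub _ (h2j.locallyIntegrable one_le_two)
      (h2s.locallyIntegrable one_le_two)]
    refine (FunctionSpaces.eLpNorm_normed_convolution_le _ (h2j.sub h2s).1 one_le_two).trans_lt ?_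
    rwa [eLpNorm_sub_comm]
  have hψs := (FunctionSpaces.memLp_normed_convolution (φ m) h2s one_le_two)
  have hψj := (FunctionSpaces.memLp_normed_convolution (φ m) h2j one_le_two)
  have hsplit : v s - ψ ⋆[lsmul ℝ ℝ, volume] v s =
      (v s - w) + (w - ψ ⋆[lsmul ℝ ℝ, volume] w) +
        (ψ ⋆[lsmul ℝ ℝ, volume] w - ψ ⋆[lsmul ℝ ℝ, volume] v s) := by abel
  refine ENNReal.toReal_le_of_le_ofReal hε.le ?_
  calc eLpNorm (v s - ψ ⋆[lsmul ℝ ℝ, volume] v s) 2 volume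
      ≤ eLpNorm (v s - w) 2 volume + eLpNorm (w - ψ ⋆[lsmul ℝ ℝ, volume] w) 2 volume +
          eLpNorm (ψ ⋆[lsmul ℝ ℝ, volume] w - ψ ⋆[lsmul ℝ ℝ, volume] v s) 2 volume := by
        rw [hsplit]
        exact (eLpNorm_add_le ((h2s.sub h2j).1.add (h2j.sub hψj).1) (hψj.sub hψs).1
          one_le_two).trans (add_le_add (eLpNorm_add_le (h2s.sub h2j).1 (h2j.sub hψj).1
            one_le_two) le_rfl)
    _ ≤ ENNReal.ofReal (ε / 3) + ENNReal.ofReal (ε / 3) + ENNReal.ofReal (ε / 3) :=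
        add_le_add (add_le_add hd1.le hd2.le) hd3.le
    _ = ENNReal.ofReal ε := by
        rw [← ENNReal.ofReal_add (by positivity) (by positivity),
          ← ENNReal.ofReal_add (by positivity) (by positivity)]
        congr 1; ring

end Uniform

/-! ### Slice-wise vanishing of the mollification error -/

section Slice

variable {v : E → E} {G : E → E →L[ℝ] E}

/-- `(φ_m ⋆ S) v → S v` in `L²` for `S = G + Gᵀ` essentially bounded and `v ∈ L²`: a.e.
convergence of the mollified (locally integrable) field `S`, uniform bound `‖φ_m ⋆ S‖ ≤ C`,
dominated convergence. [folklore] -/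
theorem tendsto_eLpNorm_normed_convolution_symGrad_sub_apply (hv2 : MemLp v 2 volume)
    (hG : HasWeakGradient v G) {C : ℝ}
    (hC : ∀ᵐ x ∂(volume : Measure E), ‖G x + adjoint (G x)‖ ≤ C) {φ : ℕ → ContDiffBump (0 : E)}
    (hφ : Tendsto (fun m => (φ m).rOut) atTop (𝓝 0)) (h'φ : ∀ m, (φ m).rOut ≤ 2 * (φ m).rIn) :
    Tendsto (fun m => eLpNorm (fun x =>
      (((φ m).normed volume ⋆[lsmul ℝ ℝ, volume] fun y => G y + adjoint (G y)) x -
        (G x + adjoint (G x))) (v x)) 2 volume) atTop (𝓝 0) := by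
  set S : E → E →L[ℝ] E := fun x => G x + adjoint (G x) with hS
  set Sn : ℕ → E → E →L[ℝ] E := fun m => (φ m).normed volume ⋆[lsmul ℝ ℝ, volume] S with hSn
  have hSl : LocallyIntegrable S volume :=
    LocallyIntegrable.add (ε'' := E →L[ℝ] E) hG.locallyIntegrable_grad
      (locallyIntegrable_adjoint hG.locallyIntegrable_grad)
  have hSm : AEStronglyMeasurable S volume := hSl.aestronglyMeasurable
  have hSn_le : ∀ m x, ‖Sn m x‖ ≤ C := fun m x => norm_normed_convolution_le_of_ae_le (φ m) hC x
  have hSn_c : ∀ m, Continuous (Sn m) := fun m =>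
    (contDiff_normed_convolution_of_locallyIntegrable (φ m) hSl (n := 0)).continuous
  have hSn_ae : ∀ᵐ x ∂(volume : Measure E), Tendsto (fun m => Sn m x) atTop (𝓝 (S x)) :=
    FunctionSpaces.ae_tendsto_normed_convolution hφ h'φ hSl
  have hSx : ∀ x, G x + adjoint (G x) = S x := fun x => rfl
  simp only [hSx]
  change Tendsto (fun m => eLpNorm (fun x => (Sn m x - S x) (v x)) 2 volume) atTop (𝓝 0)
  have hlin : Tendsto (fun m => ∫⁻ x, ‖(Sn m x - S x) (v x)‖ₑ ^ (2 : ℝ)) atTop (𝓝 0) := by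
    have hbound : ∀ m, ∀ᵐ x ∂(volume : Measure E),
        ‖(Sn m x - S x) (v x)‖ₑ ^ (2 : ℝ) ≤ (ENNReal.ofReal (2 * C)) ^ (2 : ℝ) * ‖v x‖ₑ ^ (2 : ℝ) := by
      intro m
      filter_upwards [hC] with x hx
      rw [← ENNReal.mul_rpow_of_nonneg _ _ zero_le_two]
      refine ENNReal.rpow_le_rpow ?_ zero_le_two
      have h1 : ‖(Sn m x - S x) (v x)‖ ≤ 2 * C * ‖v x‖ := by
        refine (le_opNorm _ _).trans (mul_le_mul_of_nonneg_right ?_ (norm_nonneg _))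
        exact (norm_sub_le _ _).trans (by linarith [hSn_le m x])
      rw [← ofReal_norm, ← ofReal_norm, ← ENNReal.ofReal_mul (by linarith [norm_nonneg (S x)])]
      exact ENNReal.ofReal_le_ofReal h1
    have hfin : ∫⁻ x, (ENNReal.ofReal (2 * C)) ^ (2 : ℝ) * ‖v x‖ₑ ^ (2 : ℝ) ≠ ⊤ := by
      rw [lintegral_const_mul' _ _ (ENNReal.rpow_ne_top_of_nonneg zero_le_two
        ENNReal.ofReal_ne_top), lintegral_rpow_enorm_eq_rpow_eLpNorm' zero_lt_two]
      refine ENNReal.mul_ne_top (ENNReal.rpow_ne_top_of_nonneg zero_le_two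
        ENNReal.ofReal_ne_top) (ENNReal.rpow_ne_top_of_nonneg zero_le_two ?_)
      have := hv2.eLpNorm_lt_top
      rw [eLpNorm_eq_eLpNorm' two_ne_zero ENNReal.ofNat_ne_top] at this
      simpa using this.ne
    have hmeas : ∀ m, AEMeasurable (fun x => ‖(Sn m x - S x) (v x)‖ₑ ^ (2 : ℝ)) volume :=
      fun m => (aestronglyMeasurable_clm_apply ((hSn_c m).aestronglyMeasurable.sub hSm)
        hv2.1).enorm.pow_const _
    have hlim : ∀ᵐ x ∂(volume : Measure E),
        Tendsto (fun m => ‖(Sn m x - S x) (v x)‖ₑ ^ (2 : ℝ)) atTop (𝓝 0) := by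
      filter_upwards [hSn_ae] with x hx
      have h2 : Tendsto (fun m => Sn m x - S x) atTop (𝓝 0) := by
        simpa using hx.sub_const (S x)
      have h1 : Tendsto (fun m => (Sn m x - S x) (v x)) atTop (𝓝 ((0 : E →L[ℝ] E) (v x))) :=
        ((ContinuousLinearMap.apply ℝ E (v x)).continuous.tendsto 0).comp h2
      rw [_root_.zero_apply] at h1
      have h4 : Tendsto (fun m => ‖(Sn m x - S x) (v x)‖ₑ) atTop (𝓝 0) := by
        rw [← enorm_zero (E := E)]
        exact h1.enorm
      have h5 := ((ENNReal.continuous_rpow_const (y := (2 : ℝ))).tendsto 0).comp h4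
      rw [ENNReal.zero_rpow_of_pos zero_lt_two] at h5
      exact h5
    have := tendsto_lintegral_of_dominated_convergence' _ hmeas hbound hfin hlim
    simpa using this
  have h2 : ∀ m, eLpNorm (fun x => (Sn m x - S x) (v x)) 2 volume =
      (∫⁻ x, ‖(Sn m x - S x) (v x)‖ₑ ^ (2 : ℝ)) ^ (1 / 2 : ℝ) := fun m => by
    rw [eLpNorm_eq_lintegral_rpow_enorm_toReal two_ne_zero ENNReal.ofNat_ne_top, ENNReal.toReal_ofNat]
  simp_rw [h2]
  have h6 := ((ENNReal.continuous_rpow_const (y := (1 / 2 : ℝ))).tendsto 0).comp hlin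
  rw [ENNReal.zero_rpow_of_pos (by norm_num : (0 : ℝ) < 1 / 2)] at h6
  exact h6

/-- **The mollification error vanishes slice-wise.** For `v ∈ L²` weakly divergence free with
weak gradient `G`, `S = G + Gᵀ` essentially bounded, and bump kernels `φ_m → δ₀`:
`K‖φ_m⋆(Sv) - (φ_m⋆S)v‖_{L²} + |∫⟪φ_m⋆(Sv), v⟫ - ½∫⟪(φ_m⋆S)v, v⟫| → 0`, because both
`φ_m⋆(Sv)` and `(φ_m⋆S)v` tend to `Sv` in `L²` and `∫⟪Sv, v⟫ = 0`
(`integral_inner_symGrad_apply_self_eq_zero`). [folklore] -/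
theorem tendsto_sliceErr (hv2 : MemLp v 2 volume) (hdiv : IsWeaklyDivFree v)
    (hG : HasWeakGradient v G) {C : ℝ}
    (hC : ∀ᵐ x ∂(volume : Measure E), ‖G x + adjoint (G x)‖ ≤ C) {φ : ℕ → ContDiffBump (0 : E)}
    (hφ : Tendsto (fun m => (φ m).rOut) atTop (𝓝 0)) (h'φ : ∀ m, (φ m).rOut ≤ 2 * (φ m).rIn)
    (K : ℝ) :
    Tendsto (fun m =>
      K * (eLpNorm (fun x =>
          ((φ m).normed volume ⋆[lsmul ℝ ℝ, volume] fun y => (G y + adjoint (G y)) (v y)) x -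
            (((φ m).normed volume ⋆[lsmul ℝ ℝ, volume] fun y => G y + adjoint (G y)) x) (v x))
          2 volume).toReal +
        |(∫ x, ⟪((φ m).normed volume ⋆[lsmul ℝ ℝ, volume]
            fun y => (G y + adjoint (G y)) (v y)) x, v x⟫) -
          2⁻¹ * ∫ x, ⟪(((φ m).normed volume ⋆[lsmul ℝ ℝ, volume]
            fun y => G y + adjoint (G y)) x) (v x), v x⟫|) atTop (𝓝 0) := by
  have hT2 := tendsto_eLpNorm_normed_convolution_symGrad_sub_apply hv2 hG hC hφ h'φ
  have hX := integral_inner_symGrad_apply_self_eq_zero hv2 hdiv hG hC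
  set S : E → E →L[ℝ] E := fun x => G x + adjoint (G x) with hS
  have hSx : ∀ x, G x + adjoint (G x) = S x := fun x => rfl
  simp only [hSx] at hT2 hX ⊢
  set Sn : ℕ → E → E →L[ℝ] E := fun m => (φ m).normed volume ⋆[lsmul ℝ ℝ, volume] S with hSn
  set A : E → E := fun y => S y (v y) with hA
  set An : ℕ → E → E := fun m => (φ m).normed volume ⋆[lsmul ℝ ℝ, volume] A with hAn
  change Tendsto (fun m => K * (eLpNorm (fun x => An m x - Sn m x (v x)) 2 volume).toReal +
    |(∫ x, ⟪An m x, v x⟫) - 2⁻¹ * ∫ x, ⟪Sn m x (v x), v x⟫|) atTop (𝓝 0)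
  change Tendsto (fun m => eLpNorm (fun x => (Sn m x - S x) (v x)) 2 volume) atTop (𝓝 0) at hT2
  change ∫ x, ⟪A x, v x⟫ = 0 at hX
  have hC0 : 0 ≤ C := by
    obtain ⟨x, hx⟩ := hC.exists
    exact (norm_nonneg _).trans hx
  have hSl : LocallyIntegrable S volume :=
    LocallyIntegrable.add (ε'' := E →L[ℝ] E) hG.locallyIntegrable_grad
      (locallyIntegrable_adjoint hG.locallyIntegrable_grad)
  have hSm : AEStronglyMeasurable S volume := hSl.aestronglyMeasurable
  have hCn : ∀ᵐ x ∂(volume : Measure E), ‖S x‖ ≤ (C.toNNReal : ℝ) :=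
    hC.mono fun x hx => hx.trans (Real.le_coe_toNNReal C)
  have hA2 : MemLp A 2 volume := (memLp_clm_apply_of_ae_norm_le hSm hv2 hCn).1
  have hAn2 : ∀ m, MemLp (An m) 2 volume := fun m =>
    FunctionSpaces.memLp_normed_convolution (φ m) hA2 one_le_two
  have hSn_le : ∀ m x, ‖Sn m x‖ ≤ C := fun m x => norm_normed_convolution_le_of_ae_le (φ m) hC x
  have hSn_c : ∀ m, Continuous (Sn m) := fun m =>
    (contDiff_normed_convolution_of_locallyIntegrable (φ m) hSl (n := 0)).continuous
  have hB2 : ∀ m, MemLp (fun x => Sn m x (v x)) 2 volume := fun m =>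
    (memLp_clm_apply_of_ae_norm_le (hSn_c m).aestronglyMeasurable hv2 (C := C.toNNReal)
      (ae_of_all _ fun x => (hSn_le m x).trans (Real.le_coe_toNNReal C))).1
  -- `φ_m ⋆ (S v) → S v`
  have hT1 : Tendsto (fun m => eLpNorm (An m - A) 2 volume) atTop (𝓝 0) :=
    FunctionSpaces.tendsto_eLpNorm_normed_convolution_sub_self (μ := (volume : Measure E)) hφ
      one_le_two ENNReal.ofNat_ne_top hA2
  -- `(φ_m ⋆ S) v → S v`
  have hT2' : Tendsto (fun m => eLpNorm ((fun x => Sn m x (v x)) - A) 2 volume) atTop (𝓝 0) := by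
    refine hT2.congr fun m => ?_
    congr 1
  -- the difference
  have hD : Tendsto (fun m => (eLpNorm (fun x => An m x - Sn m x (v x)) 2 volume).toReal) atTop
      (𝓝 0) := by
    have hD' : Tendsto (fun m => eLpNorm (fun x => An m x - Sn m x (v x)) 2 volume) atTop
        (𝓝 0) := by
      have hle : ∀ m, eLpNorm (fun x => An m x - Sn m x (v x)) 2 volume ≤
          eLpNorm (An m - A) 2 volume + eLpNorm ((fun x => Sn m x (v x)) - A) 2 volume := by
        intro m
        have heq : (fun x => An m x - Sn m x (v x)) =
            (An m - A) - ((fun x => Sn m x (v x)) - A) := by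
          ext1 x; simp only [Pi.sub_apply]; abel
        rw [heq]
        exact eLpNorm_sub_le ((hAn2 m).sub hA2).1 ((hB2 m).sub hA2).1 one_le_two
      refine tendsto_of_tendsto_of_tendsto_of_le_of_le tendsto_const_nhds ?_
        (fun _ => zero_le) hle
      simpa using hT1.add hT2'
    rw [← ENNReal.toReal_zero]
    exact (ENNReal.tendsto_toReal ENNReal.zero_ne_top).comp hD'
  -- the pairings
  have hP1 : Tendsto (fun m => ∫ x, ⟪An m x, v x⟫) atTop (𝓝 (∫ x, ⟪A x, v x⟫)) :=
    tendsto_integral_inner_left_of_tendsto_eLpNorm hv2 (Eventually.of_forall hAn2) hA2 hT1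
  have hP2 : Tendsto (fun m => ∫ x, ⟪Sn m x (v x), v x⟫) atTop (𝓝 (∫ x, ⟪A x, v x⟫)) :=
    tendsto_integral_inner_left_of_tendsto_eLpNorm hv2 (Eventually.of_forall hB2) hA2 hT2'
  rw [hX] at hP1 hP2
  have := (hD.const_mul K).add ((hP1.sub (hP2.const_mul 2⁻¹)).abs)
  simpa using this

end Slice

/-! ### The time-integrated mollification error vanishes -/

section TimeError

variable {T : ℝ} {v₀ : E → E} {v : ℝ → E → E} {G : ℝ → E → E →L[ℝ] E}

set_option maxHeartbeats 800000 in
/-- **Dominated convergence in time for the mollification error.** Under condition (8) (with a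
jointly measurable gradient witness) and `‖v(s)‖_{L²} ≤ R` on `[0,T]`,
`∫₀ᵀ (K‖φ_m⋆(Sv) - (φ_m⋆S)v‖_{L²} + |∫⟪φ_m⋆(Sv),v⟫ - ½∫⟪(φ_m⋆S)v,v⟫|) ds → 0` as the bump
kernels `φ_m → δ₀`: slice-wise convergence (`tendsto_sliceErr`), domination by
`(2KR + 2R²)‖S(s)‖_∞ ∈ L¹(0,T)`, measurability in `s` through a jointly measurable version of
`v`. [folklore] -/
theorem tendsto_lintegral_sliceErr (hv : IsWeakNSSolutionOn T 0 0 v₀ v)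
    (hG : ∀ᵐ t ∂(volume.restrict (Ioo 0 T)), HasWeakGradient (v t) (G t))
    (hGm : StronglyMeasurable (uncurry G))
    (hS : ∫⁻ t in Ioo 0 T, eLpNorm (fun x => G t x + adjoint (G t x)) ∞ volume < ∞)
    {R : ℝ≥0} (hR : ∀ s ∈ Icc 0 T, eLpNorm (v s) 2 volume ≤ R) {φ : ℕ → ContDiffBump (0 : E)}
    (hφ : Tendsto (fun m => (φ m).rOut) atTop (𝓝 0)) (h'φ : ∀ m, (φ m).rOut ≤ 2 * (φ m).rIn)
    {K : ℝ} (hK : 0 ≤ K) :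
    Tendsto (fun m => ∫⁻ s in Ioo 0 T, ENNReal.ofReal
      (K * (eLpNorm (fun x =>
          ((φ m).normed volume ⋆[lsmul ℝ ℝ, volume] fun y => (G s y + adjoint (G s y)) (v s y)) x -
            (((φ m).normed volume ⋆[lsmul ℝ ℝ, volume] fun y => G s y + adjoint (G s y)) x)
              (v s x)) 2 volume).toReal +
        |(∫ x, ⟪((φ m).normed volume ⋆[lsmul ℝ ℝ, volume]
            fun y => (G s y + adjoint (G s y)) (v s y)) x, v s x⟫) -
          2⁻¹ * ∫ x, ⟪(((φ m).normed volume ⋆[lsmul ℝ ℝ, volume]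
            fun y => G s y + adjoint (G s y)) x) (v s x), v s x⟫|)) atTop (𝓝 0) := by
  -- ### notation
  set S : ℝ → E → E →L[ℝ] E := fun t x => G t x + adjoint (G t x) with hSdef
  have hSx : ∀ s x, G s x + adjoint (G s x) = S s x := fun s x => rfl
  simp only [hSx]
  set μT : Measure ℝ := volume.restrict (Ioo 0 T) with hμT
  set Sv : ℕ → ℝ → E → E := fun m s =>
    (φ m).normed volume ⋆[lsmul ℝ ℝ, volume] fun y => S s y (v s y) with hSv
  set SS : ℕ → ℝ → E → E →L[ℝ] E := fun m s x =>
    ((φ m).normed volume ⋆[lsmul ℝ ℝ, volume] S s) x with hSS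
  set err : ℕ → ℝ → ℝ := fun m s =>
    K * (eLpNorm (fun x => Sv m s x - SS m s x (v s x)) 2 volume).toReal +
      |(∫ x, ⟪Sv m s x, v s x⟫) - 2⁻¹ * ∫ x, ⟪SS m s x (v s x), v s x⟫| with herr
  change Tendsto (fun m => ∫⁻ s, ENNReal.ofReal (err m s) ∂μT) atTop (𝓝 0)
  set c : ℝ → ℝ := fun s => (eLpNorm (S s) ∞ volume).toReal with hcdef
  have hSm : StronglyMeasurable (uncurry S) := stronglyMeasurable_uncurry_symGrad hGm
  have hcm : Measurable fun s => eLpNorm (S s) ∞ volume :=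
    FunctionSpaces.measurable_eLpNorm_slice hSm ∞
  have hR0 : 0 ≤ (R : ℝ) := R.2
  have hgood := euler_ae_good_time hv hG hGm hS
  -- `L²` membership of the slices at good times
  have hv2_of : ∀ {s}, s ∈ Ioo 0 T → HasWeakGradient (v s) (G s) → MemLp (v s) 2 volume :=
    fun hs hGs => ⟨hGs.locallyIntegrable_self.aestronglyMeasurable,
      (hR _ (Ioo_subset_Icc_self hs)).trans_lt ENNReal.coe_lt_top⟩
  -- ### pointwise limit
  have hlim : ∀ᵐ s ∂μT, Tendsto (fun m => ENNReal.ofReal (err m s)) atTop (𝓝 0) := by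
    filter_upwards [hgood] with s hs
    obtain ⟨hsI, hdiv, hGs, -, hae⟩ := hs
    have h := tendsto_sliceErr (hv2_of hsI hGs) hdiv hGs hae hφ h'φ K
    have h' := (ENNReal.continuous_ofReal.tendsto 0).comp h
    rw [ENNReal.ofReal_zero] at h'
    exact h'
  -- ### domination
  set Ce : ℝ := 2 * K * R + 2 * R * R with hCe
  have hCe0 : 0 ≤ Ce := by positivity
  have hbound : ∀ m, ∀ᵐ s ∂μT, ENNReal.ofReal (err m s) ≤ ENNReal.ofReal Ce * eLpNorm (S s) ∞ volume := by
    intro m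
    filter_upwards [hgood] with s hs
    obtain ⟨hsI, -, hGs, hct, hae⟩ := hs
    have hsIcc : s ∈ Icc 0 T := Ioo_subset_Icc_self hsI
    have hvs : MemLp (v s) 2 volume := hv2_of hsI hGs
    have hc0 : 0 ≤ c s := ENNReal.toReal_nonneg
    have hNv : (eLpNorm (v s) 2 volume).toReal ≤ R := by
      have := ENNReal.toReal_mono ENNReal.coe_ne_top (hR s hsIcc)
      rwa [ENNReal.coe_toReal] at this
    set Cn : ℝ≥0 := ⟨c s, hc0⟩ with hCn
    have hSSle : ∀ x, ‖SS m s x‖ ≤ c s := fun x => norm_normed_convolution_le_of_ae_le (φ m) hae x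
    obtain ⟨hSvt2, hSvt_le⟩ := memLp_clm_apply_of_ae_norm_le
      ((hSm.of_uncurry_left (x := s)).aestronglyMeasurable) hvs (C := Cn) hae
    have hSv2 : MemLp (Sv m s) 2 volume :=
      FunctionSpaces.memLp_normed_convolution (φ m) hSvt2 one_le_two
    have hSv_le : (eLpNorm (Sv m s) 2 volume).toReal ≤ c s * R := by
      have h1 := (FunctionSpaces.eLpNorm_normed_convolution_le (φ m) hSvt2.1 one_le_two).trans
        hSvt_le
      have := ENNReal.toReal_mono (ENNReal.mul_ne_top ENNReal.coe_ne_top hvs.eLpNorm_ne_top) h1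
      rw [ENNReal.toReal_mul, ENNReal.coe_toReal] at this
      exact this.trans (mul_le_mul_of_nonneg_left hNv hc0)
    obtain ⟨hSSv2, hSSv_le'⟩ := memLp_clm_apply_of_norm_le (A := SS m s) hvs
      ((stronglyMeasurable_uncurry_convolution_lsmul (φ m).continuous_normed hSm).of_uncurry_left
        (x := s)).aestronglyMeasurable (M := Cn) hSSle
    have hSSv_le : (eLpNorm (fun x => SS m s x (v s x)) 2 volume).toReal ≤ c s * R := by
      have := ENNReal.toReal_mono (ENNReal.mul_ne_top ENNReal.coe_ne_top hvs.eLpNorm_ne_top)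
        hSSv_le'
      rw [ENNReal.toReal_mul, ENNReal.coe_toReal] at this
      exact this.trans (mul_le_mul_of_nonneg_left hNv hc0)
    have hr_le : (eLpNorm (fun x => Sv m s x - SS m s x (v s x)) 2 volume).toReal ≤
        2 * (c s * R) := by
      have h := ENNReal.toReal_mono
        (ENNReal.add_ne_top.2 ⟨hSv2.eLpNorm_ne_top, hSSv2.eLpNorm_ne_top⟩)
        (eLpNorm_sub_le hSv2.1 hSSv2.1 one_le_two)
      rw [ENNReal.toReal_add hSv2.eLpNorm_ne_top hSSv2.eLpNorm_ne_top] at h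
      have h' : eLpNorm (fun x => Sv m s x - SS m s x (v s x)) 2 volume =
          eLpNorm (Sv m s - fun x => SS m s x (v s x)) 2 volume := rfl
      rw [h']
      linarith
    have hcφ_le : |(∫ x, ⟪Sv m s x, v s x⟫) - 2⁻¹ * ∫ x, ⟪SS m s x (v s x), v s x⟫| ≤
        2 * R * R * c s := by
      have h3 : |(∫ x, ⟪Sv m s x, v s x⟫)| ≤ c s * R * R :=
        (abs_integral_inner_le_toReal_eLpNorm_mul hSv2 hvs).trans
          (mul_le_mul hSv_le hNv ENNReal.toReal_nonneg (by positivity))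
      have h4 : |∫ x, ⟪SS m s x (v s x), v s x⟫| ≤ c s * R * R :=
        (abs_integral_inner_le_toReal_eLpNorm_mul hSSv2 hvs).trans
          (mul_le_mul hSSv_le hNv ENNReal.toReal_nonneg (by positivity))
      have h5 : |2⁻¹ * ∫ x, ⟪SS m s x (v s x), v s x⟫| ≤ 2⁻¹ * (c s * R * R) := by
        rw [abs_mul, abs_of_pos (by norm_num : (0:ℝ) < 2⁻¹)]
        exact mul_le_mul_of_nonneg_left h4 (by norm_num)
      calc |(∫ x, ⟪Sv m s x, v s x⟫) - 2⁻¹ * ∫ x, ⟪SS m s x (v s x), v s x⟫|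
          ≤ |∫ x, ⟪Sv m s x, v s x⟫| + |2⁻¹ * ∫ x, ⟪SS m s x (v s x), v s x⟫| := abs_sub _ _
        _ ≤ c s * R * R + 2⁻¹ * (c s * R * R) := add_le_add h3 h5
        _ ≤ 2 * R * R * c s := by nlinarith [mul_nonneg (mul_nonneg hc0 hR0) hR0]
    have herr_le : err m s ≤ Ce * c s := by
      have herr_s : err m s = K * (eLpNorm (fun x => Sv m s x - SS m s x (v s x)) 2 volume).toReal +
          |(∫ x, ⟪Sv m s x, v s x⟫) - 2⁻¹ * ∫ x, ⟪SS m s x (v s x), v s x⟫| := by rw [herr]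
      rw [herr_s]
      calc K * (eLpNorm (fun x => Sv m s x - SS m s x (v s x)) 2 volume).toReal +
            |(∫ x, ⟪Sv m s x, v s x⟫) - 2⁻¹ * ∫ x, ⟪SS m s x (v s x), v s x⟫|
          ≤ K * (2 * (c s * R)) + 2 * R * R * c s :=
            add_le_add (mul_le_mul_of_nonneg_left hr_le hK) hcφ_le
        _ = Ce * c s := by rw [hCe]; ring
    calc ENNReal.ofReal (err m s) ≤ ENNReal.ofReal (Ce * c s) := ENNReal.ofReal_le_ofReal herr_le
      _ = ENNReal.ofReal Ce * ENNReal.ofReal (c s) := ENNReal.ofReal_mul hCe0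
      _ ≤ ENNReal.ofReal Ce * eLpNorm (S s) ∞ volume :=
          mul_le_mul' le_rfl ENNReal.ofReal_toReal_le
  have hfin : ∫⁻ s, ENNReal.ofReal Ce * eLpNorm (S s) ∞ volume ∂μT ≠ ⊤ := by
    rw [lintegral_const_mul _ hcm]
    exact ENNReal.mul_ne_top ENNReal.ofReal_ne_top hS.ne
  -- ### measurability (through a jointly measurable version of `v`)
  have hmeas : ∀ m, AEMeasurable (fun s => ENNReal.ofReal (err m s)) μT := by
    intro m
    have hvm : AEStronglyMeasurable (uncurry v) (μT.prod (volume : Measure E)) := by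
      rw [hμT, restrict_prod_volume_eq]; exact hv.1
    have hRae : ∀ᵐ s ∂μT, eLpNorm (v s) 2 volume ≤ R := by
      filter_upwards [ae_restrict_mem measurableSet_Ioo] with s hs
      exact hR s (Ioo_subset_Icc_self hs)
    obtain ⟨vt, hvtm, -, hvt⟩ := exists_version_of_eLpNorm_le hvm hRae
    set ψ : E → ℝ := (φ m).normed volume with hψ
    set At : ℝ → E → E := fun s x => S s x (vt s x) with hAt
    have hAtm : StronglyMeasurable (uncurry At) :=
      (ContinuousLinearMap.id ℝ (E →L[ℝ] E)).continuous₂.comp_stronglyMeasurable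
        (hSm.prodMk hvtm)
    have hP1m : StronglyMeasurable (uncurry fun s x => (ψ ⋆[lsmul ℝ ℝ, volume] At s) x) :=
      stronglyMeasurable_uncurry_convolution_lsmul (φ m).continuous_normed hAtm
    have hP2m : StronglyMeasurable (uncurry fun s x => (ψ ⋆[lsmul ℝ ℝ, volume] S s) x) :=
      stronglyMeasurable_uncurry_convolution_lsmul (φ m).continuous_normed hSm
    have hP3m : StronglyMeasurable
        (uncurry fun s x => ((ψ ⋆[lsmul ℝ ℝ, volume] S s) x) (vt s x)) :=
      (ContinuousLinearMap.id ℝ (E →L[ℝ] E)).continuous₂.comp_stronglyMeasurable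
        (hP2m.prodMk hvtm)
    set errt : ℝ → ℝ := fun s =>
      K * (eLpNorm (fun x => (ψ ⋆[lsmul ℝ ℝ, volume] At s) x -
          ((ψ ⋆[lsmul ℝ ℝ, volume] S s) x) (vt s x)) 2 volume).toReal +
        |(∫ x, ⟪(ψ ⋆[lsmul ℝ ℝ, volume] At s) x, vt s x⟫) -
          2⁻¹ * ∫ x, ⟪((ψ ⋆[lsmul ℝ ℝ, volume] S s) x) (vt s x), vt s x⟫| with herrt
    have herrt_m : Measurable errt := by
      refine ((FunctionSpaces.measurable_eLpNorm_slice (hP1m.sub hP3m) 2).ennreal_toReal.const_mul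
        K).add ?_
      refine Measurable.comp (by fun_prop : Measurable fun r : ℝ => |r|) ?_
      have i1 : Measurable fun s => ∫ x, ⟪(ψ ⋆[lsmul ℝ ℝ, volume] At s) x, vt s x⟫ :=
        ((hP1m.inner (𝕜 := ℝ) hvtm).integral_prod_right'
          (ν := (volume : Measure E))).measurable
      have i2 : Measurable fun s => ∫ x, ⟪((ψ ⋆[lsmul ℝ ℝ, volume] S s) x) (vt s x), vt s x⟫ :=
        ((hP3m.inner (𝕜 := ℝ) hvtm).integral_prod_right'
          (ν := (volume : Measure E))).measurable
      exact i1.sub (i2.const_mul _)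
    refine herrt_m.ennreal_ofReal.aemeasurable.congr ?_
    filter_upwards [hvt] with s hs
    have hA : At s =ᵐ[volume] fun y => S s y (v s y) := by
      filter_upwards [hs] with x hx
      simp only [hAt, hx]
    have hconv : ∀ x, (ψ ⋆[lsmul ℝ ℝ, volume] At s) x = Sv m s x := fun x =>
      convolution_lsmul_congr_ae_right ψ hA x
    have e1 : eLpNorm (fun x => (ψ ⋆[lsmul ℝ ℝ, volume] At s) x -
        ((ψ ⋆[lsmul ℝ ℝ, volume] S s) x) (vt s x)) 2 volume =
        eLpNorm (fun x => Sv m s x - SS m s x (v s x)) 2 volume := by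
      refine eLpNorm_congr_ae ?_
      filter_upwards [hs] with x hx
      rw [hconv, hx]
    have e2 : ∫ x, ⟪(ψ ⋆[lsmul ℝ ℝ, volume] At s) x, vt s x⟫ = ∫ x, ⟪Sv m s x, v s x⟫ := by
      refine integral_congr_ae ?_
      filter_upwards [hs] with x hx
      rw [hconv, hx]
    have e3 : ∫ x, ⟪((ψ ⋆[lsmul ℝ ℝ, volume] S s) x) (vt s x), vt s x⟫ =
        ∫ x, ⟪SS m s x (v s x), v s x⟫ := by
      refine integral_congr_ae ?_
      filter_upwards [hs] with x hx
      rw [hx]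
    change ENNReal.ofReal (errt s) = ENNReal.ofReal (err m s)
    rw [herrt, herr]
    simp only [e1, e2, e3]
  have := tendsto_lintegral_of_dominated_convergence' _ hmeas hbound hfin hlim
  simpa using this

end TimeError

/-! ### The uniform bound on `∫₀ᵀ∫|u - v|²` -/

section Bound

variable {T ν : ℝ} {v₀ : E → E} {u v : ℝ → E → E} {G : ℝ → E → E →L[ℝ] E}

set_option maxHeartbeats 800000 in
/-- **Uniform relative-energy bound, integrated in time.** For a Leray–Hopf solution `u`
(viscosity `ν ≥ 0`) and a finite-energy Euler solution `v` with (8), same datum `v₀`,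
`‖v(s)‖_{L²} ≤ R`, a bump kernel `φ`, and real upper bounds `η₀ ≥ ‖v₀ - φ⋆v₀‖`,
`η₁ ≥ sup_s ‖v(s) - φ⋆v(s)‖`, `I ≥ ∫₀ᵀ err_φ`, `Z ≥ 2Tν‖v₀‖‖Δφ‖₁R`:
`∫₀ᵀ ∫ |u - v|² ≤ T · e^{∫₀ᵀ‖S‖_∞} · (2‖v₀‖(η₀ + η₁) + 2I + Z)`
(`leray_euler_integral_norm_sub_sq_le` slice-wise, integrated over `(0,T)`).
[cite: BrenierDeLellisSzekelyhidi2011, §3.1 proof of Thm. 2 and Cor. 1] -/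
theorem leray_euler_lintegral_enorm_sub_sq_le (hT : 0 < T) (hν : 0 ≤ ν)
    (hu : IsLerayHopfOn T ν 0 v₀ u)
    (hv : IsWeakNSSolutionOn T 0 0 v₀ v) (hc : ContinuousInLpOn (Icc 0 T) 2 v)
    (hv₀ : MemLp v₀ 2 volume) (hv₀div : IsWeaklyDivFree v₀)
    (hG : ∀ᵐ t ∂(volume.restrict (Ioo 0 T)), HasWeakGradient (v t) (G t))
    (hGm : StronglyMeasurable (uncurry G))
    (hS : ∫⁻ t in Ioo 0 T, eLpNorm (fun x => G t x + adjoint (G t x)) ∞ volume < ∞)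
    {R : ℝ≥0} (hR : ∀ s ∈ Icc 0 T, eLpNorm (v s) 2 volume ≤ R) (φ : ContDiffBump (0 : E))
    {η₀ η₁ I Z : ℝ}
    (hη₀ : (eLpNorm (v₀ - φ.normed volume ⋆[lsmul ℝ ℝ, volume] v₀) 2 volume).toReal ≤ η₀)
    (hη₁ : ∀ s ∈ Icc 0 T,
      (eLpNorm (v s - φ.normed volume ⋆[lsmul ℝ ℝ, volume] v s) 2 volume).toReal ≤ η₁)
    (hI : (∫⁻ s in Ioo 0 T, ENNReal.ofReal
          (2 * ((eLpNorm v₀ 2 volume).toReal + R) *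
            (eLpNorm (fun x => (φ.normed volume ⋆[lsmul ℝ ℝ, volume]
                fun y => (G s y + adjoint (G s y)) (v s y)) x -
              ((φ.normed volume ⋆[lsmul ℝ ℝ, volume] fun y => G s y + adjoint (G s y)) x)
                (v s x)) 2 volume).toReal +
          |(∫ x, ⟪(φ.normed volume ⋆[lsmul ℝ ℝ, volume]
              fun y => (G s y + adjoint (G s y)) (v s y)) x, v s x⟫) -
            2⁻¹ * ∫ x, ⟪((φ.normed volume ⋆[lsmul ℝ ℝ, volume]
              fun y => G s y + adjoint (G s y)) x) (v s x), v s x⟫|)).toReal ≤ I)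
    (hZ : 2 * T * (ν * (eLpNorm v₀ 2 volume).toReal *
          ((∫⁻ y, ‖(Δ (φ.normed volume)) y‖ₑ).toReal * R)) ≤ Z) :
    ∫⁻ t in Ioo 0 T, ∫⁻ x, ‖u t x - v t x‖ₑ ^ 2 ≤
      ENNReal.ofReal (T * Real.exp
        (∫⁻ s in Ioo 0 T, eLpNorm (fun x => G s x + adjoint (G s x)) ∞ volume).toReal *
        (2 * (eLpNorm v₀ 2 volume).toReal * (η₀ + η₁) + 2 * I + Z)) := by
  have hN₀0 : 0 ≤ (eLpNorm v₀ 2 volume).toReal := ENNReal.toReal_nonneg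
  have hslice : ∀ t ∈ Ioo 0 T, ∫⁻ x, ‖u t x - v t x‖ₑ ^ 2 ≤ ENNReal.ofReal (Real.exp
      (∫⁻ s in Ioo 0 T, eLpNorm (fun x => G s x + adjoint (G s x)) ∞ volume).toReal *
        (2 * (eLpNorm v₀ 2 volume).toReal * (η₀ + η₁) + 2 * I + Z)) := by
    intro t ht
    have htI : t ∈ Icc 0 T := Ioo_subset_Icc_self ht
    have hw : MemLp (u t - v t) 2 volume := (hu.memLp t htI).sub (hc.1 t htI)
    have hconv : ∫⁻ x, ‖u t x - v t x‖ₑ ^ 2 = ENNReal.ofReal (∫ x, ‖u t x - v t x‖ ^ 2) := by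
      have hint : Integrable (fun x => ‖u t x - v t x‖ ^ 2) volume :=
        hw.integrable_norm_pow two_ne_zero
      rw [ofReal_integral_eq_lintegral_ofReal hint (ae_of_all _ fun _ => by positivity)]
      refine lintegral_congr fun x => ?_
      rw [← ofReal_norm, ← ENNReal.ofReal_pow (norm_nonneg _)]
    rw [hconv]
    refine ENNReal.ofReal_le_ofReal ((leray_euler_integral_norm_sub_sq_le hT hν hu hv hc hv₀
      hv₀div hG hGm hS hR φ hη₁ ⟨ht.1, ht.2.le⟩).trans ?_)
    rw [mul_comm (Real.exp _)]
    refine mul_le_mul_of_nonneg_right ?_ (Real.exp_pos _).le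
    gcongr
  calc ∫⁻ t in Ioo 0 T, ∫⁻ x, ‖u t x - v t x‖ₑ ^ 2
      ≤ ∫⁻ _ in Ioo 0 T, ENNReal.ofReal (Real.exp
          (∫⁻ s in Ioo 0 T, eLpNorm (fun x => G s x + adjoint (G s x)) ∞ volume).toReal *
          (2 * (eLpNorm v₀ 2 volume).toReal * (η₀ + η₁) + 2 * I + Z)) := by
        refine lintegral_mono_ae ?_
        filter_upwards [ae_restrict_mem measurableSet_Ioo] with t ht
        exact hslice t ht
    _ = ENNReal.ofReal (T * Real.exp
          (∫⁻ s in Ioo 0 T, eLpNorm (fun x => G s x + adjoint (G s x)) ∞ volume).toReal *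
          (2 * (eLpNorm v₀ 2 volume).toReal * (η₀ + η₁) + 2 * I + Z)) := by
        rw [setLIntegral_const, Real.volume_Ioo, sub_zero, ← ENNReal.ofReal_mul' hT.le]
        congr 1; ring

end Bound

/-! ### The corollary -/

set_option maxHeartbeats 800000 in
/-- **Brenier–De Lellis–Székelyhidi 2011, Cor. 1 (discharged).** Let `v ∈ C([0,T]; L²(ℝⁿ))`
be a weak Euler solution with `∫₀ᵀ ‖∇v + ∇vᵀ‖_{L^∞} dt < ∞` and datum `v₀ ∈ L²_σ`, and let
`u_k` be Leray solutions of Navier–Stokes with viscosities `ν_k → 0` and the same datum. Then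
`u_k → v` in `L²((0,T) × ℝⁿ)`: `∫₀ᵀ ∫ |u_k - v|² → 0`. Proof in the module docstring.
[cite: BrenierDeLellisSzekelyhidi2011, Cor. 1] -/
theorem BrenierDeLellisSzekelyhidi2011_cor1_holds : BrenierDeLellisSzekelyhidi2011_cor1 := by
  intro n T hT v₀ hv₀ hv₀div v hEuler hc hsymm ν hν hν₀ u hLeray
  obtain ⟨G₀, hG₀, hS₀⟩ := hsymm
  have hv : IsWeakNSSolutionOn T 0 0 v₀ v := hEuler
  -- a jointly measurable gradient witness
  obtain ⟨G, hGm, hGG₀⟩ := exists_stronglyMeasurable_weakGradient hv.1 hG₀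
  have hG : ∀ᵐ t ∂(volume.restrict (Ioo 0 T)), HasWeakGradient (v t) (G t) := by
    filter_upwards [hG₀, hGG₀] with t h1 h2 using h1.congr_grad_ae h2
  have hSeq : ∀ᵐ t ∂(volume.restrict (Ioo 0 T)),
      eLpNorm (fun x => G t x + adjoint (G t x)) ∞ volume =
        eLpNorm (fun x => G₀ t x + adjoint (G₀ t x)) ∞ volume := by
    filter_upwards [hGG₀] with t ht
    refine eLpNorm_congr_ae ?_
    filter_upwards [ht] with x hx
    rw [hx]
  have hS : ∫⁻ t in Ioo 0 T, eLpNorm (fun x => G t x + adjoint (G t x)) ∞ volume < ∞ := by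
    rwa [lintegral_congr_ae hSeq]
  obtain ⟨R, hR⟩ := hc.exists_eLpNorm_le_of_Icc
  obtain ⟨φ, hφ, h'φ⟩ := FunctionSpaces.exists_contDiffBump_seq (E := EuclideanSpace ℝ (Fin n))
  -- scalar data
  set N₀ : ℝ := (eLpNorm v₀ 2 volume).toReal with hN₀
  set Λ : ℝ := (∫⁻ s in Ioo 0 T, eLpNorm (fun x => G s x + adjoint (G s x)) ∞ volume).toReal
    with hΛ
  have hN₀0 : 0 ≤ N₀ := ENNReal.toReal_nonneg
  have hCexp0 : 0 < T * Real.exp Λ := mul_pos hT (Real.exp_pos _)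
  -- ### the vanishing errors
  -- `‖v₀ - φ_m ⋆ v₀‖ → 0`
  have hη₀ : Tendsto (fun m =>
      (eLpNorm (v₀ - (φ m).normed volume ⋆[lsmul ℝ ℝ, volume] v₀) 2 volume).toReal)
      atTop (𝓝 0) := by
    have h := FunctionSpaces.tendsto_eLpNorm_normed_convolution_sub_self
      (μ := (volume : Measure (EuclideanSpace ℝ (Fin n)))) hφ one_le_two ENNReal.ofNat_ne_top hv₀
    rw [← ENNReal.toReal_zero]
    refine ((ENNReal.tendsto_toReal ENNReal.zero_ne_top).comp h).congr fun m => ?_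
    simp only [Function.comp_apply]
    rw [eLpNorm_sub_comm]
  -- `∫₀ᵀ err_{φ_m} → 0`
  have hI := (ENNReal.tendsto_toReal ENNReal.zero_ne_top).comp
    (tendsto_lintegral_sliceErr hv hG hGm hS hR hφ h'φ (K := 2 * (N₀ + R)) (by positivity))
  rw [ENNReal.toReal_zero] at hI
  -- `sup_s ‖v(s) - φ_m ⋆ v(s)‖ → 0`
  have hsup : ∀ θ : ℝ, 0 < θ → ∀ᶠ m in atTop, ∀ s ∈ Icc 0 T,
      (eLpNorm (v s - (φ m).normed volume ⋆[lsmul ℝ ℝ, volume] v s) 2 volume).toReal ≤ θ :=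
    fun θ hθ => eventually_forall_eLpNorm_sub_normed_convolution_le hc hφ hθ
  -- the viscous term, `k → ∞` at fixed `m`
  have hZ : ∀ m, Tendsto (fun k => 2 * T * (ν k * N₀ *
      ((∫⁻ y, ‖(Δ ((φ m).normed volume)) y‖ₑ).toReal * R))) atTop (𝓝 0) := fun m => by
    have := ((hν₀.mul_const N₀).mul_const
      ((∫⁻ y, ‖(Δ ((φ m).normed volume)) y‖ₑ).toReal * R)).const_mul (2 * T)
    simpa using this
  -- ### the `ε`-argument
  rw [ENNReal.tendsto_nhds_zero]
  intro ε hε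
  rcases eq_or_ne ε ⊤ with rfl | hεtop
  · exact Eventually.of_forall fun _ => le_top
  have hε'0 : 0 < ε.toReal := ENNReal.toReal_pos hε.ne' hεtop
  have hden : 0 < T * Real.exp Λ * (4 * N₀ + 3) + 1 := by positivity
  set θ : ℝ := ε.toReal / (T * Real.exp Λ * (4 * N₀ + 3) + 1) with hθ
  have hθ0 : 0 < θ := div_pos hε'0 hden
  have hθle : T * Real.exp Λ * (4 * N₀ + 3) * θ ≤ ε.toReal := by
    rw [hθ, mul_div_assoc', div_le_iff₀ hden]
    nlinarith [hε'0.le]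
  -- choose the mollification scale
  obtain ⟨m, hm1, hm2, hm3⟩ := (((tendsto_order.1 hη₀).2 θ hθ0).and
    ((((tendsto_order.1 hI).2 θ hθ0)).and (hsup θ hθ0))).exists
  -- then the viscosity
  filter_upwards [(tendsto_order.1 (hZ m)).2 θ hθ0] with k hk
  have hB := leray_euler_lintegral_enorm_sub_sq_le hT (hν k).le (hLeray k T hT) hv hc hv₀ hv₀div
    hG hGm hS hR (φ m) hm1.le hm3 hm2.le hk.le
  refine hB.trans ?_
  rw [← ENNReal.ofReal_toReal hεtop]
  refine ENNReal.ofReal_le_ofReal ?_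
  show T * Real.exp Λ * (2 * N₀ * (θ + θ) + 2 * θ + θ) ≤ ε.toReal
  have : T * Real.exp Λ * (2 * N₀ * (θ + θ) + 2 * θ + θ) =
      T * Real.exp Λ * (4 * N₀ + 3) * θ := by ring
  linarith [this, hθle]

end Literature.Barriers.AnomalousDissipation
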